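import Mathlib.NumberTheory.NumberField.Basic
import Literature.AlgebraicGeometry.Motives.FaltingsAbelian
import Literature.AlgebraicGeometry.Motives.FaltingsFinitenessI
import Literature.AlgebraicGeometry.Motives.FaltingsAbelianEndAlgebraProofs
import Literature.AlgebraicGeometry.Motives.FaltingsAbelianIsogenyProofs
import Literature.AlgebraicGeometry.Motives.AbelianVarietyEndAlgebraSemisimple
import Literature.AlgebraicGeometry.Motives.AbelianVarietyEndGaloisFinite
import Literature.AlgebraicGeometry.Motives.AbelianVarietyTorsionCubeProofs
import Literature.NumberTheory.DiophantineGeometry.AVIsogenyTateHoldsProofs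
import HarnessLib

/-!
# `FaltingsTateModuleQ` (route PhantomRMYoshida, item stmt-Langlands-15085) modulo Finiteness I

The statement item `FaltingsTateModuleQ` of route `PhantomRMYoshida` is Faltings' pair of
Tate-module theorems over `ℚ`, typed fact-free over the tree's scheme-theoretic abelian varieties
`Literature.AlgebraicGeometry.Motives.AbelianVariety ℚ` (proper, geometrically integral group
schemes over `Spec ℚ`) and the honest Tate modules `T_p B = lim← B[pⁿ](ℚ̄)` of
`Literature/NumberTheory/DiophantineGeometry/AVGaloisModule`, `…/AVIsogenyTate`:

* (i) for every prime `p` and every abelian variety `B/ℚ` the Tate map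
  `ℤ_p ⊗_ℤ End_ℚ(B) → End_{Γ_ℚ}(T_p B)`, `c ⊗ f ↦ c • T_p f` (`AbelianVariety.faltingsTateMap B B p`),
  is bijective — G. Faltings, *Endlichkeitssätze für abelsche Varietäten über Zahlkörpern*,
  Invent. Math. 73 (1983), §5, Satz 4 (= Korollar 1 with `A₁ = A₂ = B`);
* (ii) `V_p B = ℚ_p ⊗_{ℤ_p} T_p B` (`AbelianVariety.rationalTateRep B p`) is a semisimple
  `ℚ_p[Γ_ℚ]`-module — ibid., Satz 3.

The route decl itself is not yet written into `Summits/Langlands/Langlands/Theses/PhantomRMYoshida.lean`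
(its constants `faltingsTateMap` / `rationalTateRep` are outside that file's current import
closure); the theorems below are therefore stated against the item's registered signature,
verbatim, so that `Iff.rfl` / `id` transports them once the decl `FaltingsTateModuleQ` exists.

## What this file proves

* `faltingsTateModuleQ_iff_hodgeS27` — the item is, binder for binder, the conjunction over `ℚ` of
  the two Literature named facts of **hodge.S27**, `faltings_tate_bijective B B p` and
  `isSemisimpleRepresentation_rationalTateRep B p` (`Literature/AlgebraicGeometry/Motives/FaltingsAbelian`),
  whose bodies quantify an instance `[NumberField ℚ]` that Mathlib supplies (`Rat.numberField`).
  This is the form consumed by the `p = 3` motivic line of crux `StableYoshidaCongruence`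
  (`stub_tateModuleIrreducible`, whose first two hypotheses are exactly the right-hand side).
* `faltingsTateModuleQ_of_finite_isoClasses_isogenous` — **the item follows from Finiteness I
  over `ℚ` and nothing else**: granted `AbelianVariety.finite_isoClasses_isogenous P` for every
  abelian variety `P/ℚ` (up to isomorphism only finitely many `B/ℚ` are isogenous to `P`;
  Faltings 1983, §6, Satz 6 with Zarhin's trick; J. S. Milne, *Abelian Varieties* (2008), Ch. IV,
  Thm. 1.1), both (i) and (ii) hold, through the tree's sorry-free deduction of §5 from
  Finiteness I (`Literature/AlgebraicGeometry/Motives/FaltingsAbelianEndAlgebraProofs`,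
  `…FaltingsAbelianProofs`, `…FaltingsAbelianSemisimpleProofs`, assembled over number fields in
  `…FaltingsAbelianOfFinitenessIProofs`: Tate's 1966 lattice argument; quotients by finite
  Galois-stable subgroups, `exists_quotient_isogeny_holds`; `End_ℚ(B)` finitely generated with
  injective Tate map, Mumford §19 Thm. 3, `module_finite_hom_holds` from the Theorem of the Cube;
  Poincaré's complete reducibility over `ℚ̄`, `isSemisimpleRing_endAlgebra_of_isAlgClosed`, and its
  Galois descent to the perfect field `ℚ` — all theorems of the tree; axiom closure of the theorem
  below: `propext`, `Classical.choice`, `Quot.sound`).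

So the one remaining input of item stmt-Langlands-15085 is the named fact
`Literature.AlgebraicGeometry.Motives.AbelianVariety.finite_isoClasses_isogenous` over `ℚ`
(Faltings' theorem proper: heights on the moduli space of abelian varieties, Tate–Raynaud,
the Hodge–Tate decomposition; not formalised anywhere).

## References

* [Faltings1983Endlichkeit] G. Faltings, Invent. Math. 73 (1983), 349–366, §5 Satz 3–4,
  Korollar 1; §6 Satz 6.
* [Faltings1986FinitenessTranslation] English translation, Cornell–Silverman (eds.), *Arithmetic
  Geometry* (1986), Ch. II, §5 Theorems 3–4, §6 Theorem 6.
* [MilneAV2008] J. S. Milne, *Abelian Varieties* (2008), Ch. IV, Thm. 1.1, §2.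
-/

set_option linter.dupNamespace false

noncomputable section

open Literature.AlgebraicGeometry.Motives
open Literature.AlgebraicGeometry.Motives.AbelianVariety

namespace Summit.Langlands.Langlands.Theorems

open CategoryTheory in
/-- `End⁰_ℚ(P) = ℚ ⊗ End_ℚ(P)` is a semisimple ring for every abelian variety `P/ℚ` (Mumford,
*Abelian Varieties*, §19, Cor. 2 of Thm. 1, p. 174, over `ℚ̄`: the tree's
`isSemisimpleRing_endAlgebra_of_isAlgClosed`, Poincaré's complete reducibility; descended to `ℚ`:
`Gal(ℚ̄/ℚ)` acts on `End(P_ℚ̄)` through a finite quotient, `finite_range_toRingHom_galois`, fixes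
base changes, `smul_end_baseChange`, every fixed endomorphism descends over the perfect field `ℚ`,
`exists_end_of_baseChange_eq_of_forall_smul_eq`, and semisimplicity descends to the fixed ring,
`isSemisimpleRing_endAlgebra_of_fixedPoints`). This is the tree theorem
`AbelianVariety.isSemisimpleRing_endAlgebra_of_perfectField`
(`Literature/AlgebraicGeometry/Motives/FaltingsAbelianOfFinitenessIProofs`) at `K = ℚ`, re-derived
here in a few lines from the descent files it rests on, which keeps this file's import closure
inside the Galois-descent / Theorem-of-the-Cube chain actually cited. -/
private theorem isSemisimpleRing_endAlgebra_rat (P : AbelianVariety ℚ) :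
    IsSemisimpleRing (endAlgebra P) := by
  let φ : End P →+* End (P.baseChange (AlgebraicClosure ℚ)) :=
    RingHom.mk' ((baseChangeFunctor ℚ (AlgebraicClosure ℚ)).mapEnd P)
      (fun f g ↦ Hom.baseChange_add (AlgebraicClosure ℚ) f g)
  have hφ : ∀ f : End P, φ f = End.of (Hom.baseChange (AlgebraicClosure ℚ) f) := fun _ ↦ rfl
  have hφinj : Function.Injective φ := fun _ _ hfg ↦
    Hom.baseChange_injective (AlgebraicClosure ℚ) hfg
  have hfg : Module.Finite ℤ (End (P.baseChange (AlgebraicClosure ℚ))) :=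
    module_finite_hom_holds _ _
  have htf : Module.IsTorsionFree ℤ (End (P.baseChange (AlgebraicClosure ℚ))) :=
    isTorsionFree_int_hom_of_isIsogeny_zsmul_id
      (isIsogeny_zsmul_id_holds (P.baseChange (AlgebraicClosure ℚ)))
  have hss' : IsSemisimpleRing (endAlgebra (P.baseChange (AlgebraicClosure ℚ))) :=
    isSemisimpleRing_endAlgebra_of_isAlgClosed _
  exact isSemisimpleRing_endAlgebra_of_fixedPoints (P.finite_range_toRingHom_galois hfg htf) φ hφinj
    (fun γ f ↦ P.smul_end_baseChange (AlgebraicClosure ℚ) γ f)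
    (fun r hr ↦ by
      obtain ⟨f, hf⟩ := P.exists_end_of_baseChange_eq_of_forall_smul_eq (AlgebraicClosure ℚ) r hr
      exact ⟨f, (hφ f).trans hf⟩)
    hss'

/-- **`FaltingsTateModuleQ` is the conjunction over `ℚ` of the two hodge.S27 named facts.**
The item's fact-free signature — (i) bijectivity of the Tate map
`ℤ_p ⊗ End_ℚ(B) → End_{Γ_ℚ}(T_p B)` and (ii) semisimplicity of `V_p B`, for all primes `p` and all
abelian varieties `B/ℚ` — is equivalent to
`(∀ p B, faltings_tate_bijective B B p) ∧ (∀ p B, isSemisimpleRepresentation_rationalTateRep B p)`,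
the Literature named facts for Faltings 1983, §5, Satz 4 / Korollar 1 and Satz 3
(`Literature/AlgebraicGeometry/Motives/FaltingsAbelian`); their bodies read `∀ [NumberField ℚ], …`
and the instance is Mathlib's `Rat.numberField`, so both directions are re-binding. -/
theorem faltingsTateModuleQ_iff_hodgeS27 :
    ((∀ (p : ℕ) [Fact p.Prime] (B : AbelianVariety ℚ),
        Function.Bijective (faltingsTateMap B B p)) ∧
      (∀ (p : ℕ) [Fact p.Prime] (B : AbelianVariety ℚ),
        (rationalTateRep B p).IsSemisimpleRepresentation)) ↔
    ((∀ (p : ℕ) [Fact p.Prime] (B : AbelianVariety ℚ), faltings_tate_bijective B B p) ∧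
      (∀ (p : ℕ) [Fact p.Prime] (B : AbelianVariety ℚ),
        isSemisimpleRepresentation_rationalTateRep B p)) := by
  constructor
  · rintro ⟨h1, h2⟩
    constructor
    · intro p _ B _
      exact h1 p B
    · intro p _ B _
      exact h2 p B
  · rintro ⟨h1, h2⟩
    constructor
    · intro p _ B
      exact h1 p B
    · intro p _ B
      exact h2 p B

/-- **`FaltingsTateModuleQ` from Finiteness I over `ℚ` alone.** Granted Finiteness I for every
abelian variety `P/ℚ` (`hfin : ∀ P, AbelianVariety.finite_isoClasses_isogenous P` — Faltings,
Invent. Math. 73 (1983), §6, Satz 6 with Zarhin's trick; Milne, *Abelian Varieties* (2008), Ch. IV,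
Thm. 1.1: up to isomorphism only finitely many `B/ℚ` are isogenous to `P`), for every prime `p`
and every abelian variety `B/ℚ`: (i) the Tate map `ℤ_p ⊗_ℤ End_ℚ(B) → End_{Γ_ℚ}(T_p B)`,
`c ⊗ f ↦ c • T_p f`, is bijective (Faltings 1983, §5, Satz 4) and (ii) `V_p B` is a semisimple
`ℚ_p[Γ_ℚ]`-module (Satz 3). Proof: the tree's deduction of §5 from Finiteness I with the
printed inputs, `faltings_tate_end_bijective_of_finitenessI_of_endAlgebra_of_module_finite_hom`
(Satz 4 for `B` from Finiteness I for `B ⊞ B`, quotients `exists_quotient_isogeny_holds`,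
`End⁰_ℚ(B)` semisimple, `End_ℚ(B)` finitely generated `module_finite_hom_holds`) and
`isSemisimpleRepresentation_rationalTateRep_of_finitenessI_of_endAlgebra` (Satz 3 from Finiteness I
for `B`, quotients, `finiteDimensional_endAlgebra_holds`, `End⁰_ℚ(B)` semisimple), specialised to
the number field `ℚ` (`Rat.numberField`). Every other input
of the printed proof (Tate's lattice argument, quotient isogenies, Mumford §19 Thm. 3, Poincaré
reducibility with Galois descent) is a theorem of the tree, so Finiteness I is the item's single
outstanding named fact. -/
theorem faltingsTateModuleQ_of_finite_isoClasses_isogenous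
    (hfin : ∀ P : AbelianVariety ℚ, finite_isoClasses_isogenous P) :
    (∀ (p : ℕ) [Fact p.Prime] (B : AbelianVariety ℚ),
        Function.Bijective (faltingsTateMap B B p)) ∧
      (∀ (p : ℕ) [Fact p.Prime] (B : AbelianVariety ℚ),
        (rationalTateRep B p).IsSemisimpleRepresentation) := by
  -- `End⁰_ℚ(P)` is semisimple for every `P/ℚ`: Poincaré over `ℚ̄` descended to the fixed ring
  have hss : ∀ P : AbelianVariety ℚ, IsSemisimpleRing (endAlgebra P) :=
    fun P ↦ isSemisimpleRing_endAlgebra_rat P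
  constructor
  · intro p _ B
    -- Satz 4 for `B` from Finiteness I for `B ⊞ B` (Tate's lattice argument on `B × B`)
    exact faltings_tate_end_bijective_of_finitenessI_of_endAlgebra_of_module_finite_hom B p
      (hfin _) (exists_quotient_isogeny_holds _ p) (hss B) (module_finite_hom_holds B B)
  · intro p _ B
    -- Satz 3 from Finiteness I for `B`
    exact isSemisimpleRepresentation_rationalTateRep_of_finitenessI_of_endAlgebra B p (hfin B)
      (exists_quotient_isogeny_holds B p) (finiteDimensional_endAlgebra_holds B) (hss B)

open CategoryTheory in
/-- **`FaltingsTateModuleQ` from the parallel gate item `FaltingsFinitenessI` (stmt-Langlands-15084)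
as registered.** The hypothesis `h` is, verbatim, the registered signature of the route's named-fact
gate `FaltingsFinitenessI` — Finiteness I over `ℚ` (for every abelian variety `A/ℚ` finitely many
`B/ℚ`, up to isomorphism in `AbelianVariety ℚ`, admit an isogeny `B → A`; Faltings, Invent. Math.
73 (1983), §6, Satz 6 with Zarhin's trick; Milne, *Abelian Varieties* (2008), Ch. IV, Thm. 1.1),
i.e. the tree's named fact `AbelianVariety.finite_isoClasses_isogenous A` with its `[NumberField ℚ]`
binder instantiated; the conclusion is, verbatim, the registered signature of `FaltingsTateModuleQ`
(stmt-Langlands-15085: Faltings 1983, §5, Satz 4 ∧ Satz 3 over `ℚ`). So, in the tree, the gate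
`FaltingsTateModuleQ` is a DERIVED consequence of the gate `FaltingsFinitenessI`
(`faltingsTateModuleQ_of_finite_isoClasses_isogenous` after re-binding the instance). -/
theorem faltingsTateModuleQ_of_faltingsFinitenessI
    (h : ∀ A : AbelianVariety ℚ, ∃ (n : ℕ) (C : Fin n → AbelianVariety ℚ),
      ∀ B : AbelianVariety ℚ, IsIsogenous B A → ∃ i, Nonempty (B ≅ C i)) :
    (∀ (p : ℕ) [Fact p.Prime] (B : AbelianVariety ℚ),
        Function.Bijective (faltingsTateMap B B p)) ∧
      (∀ (p : ℕ) [Fact p.Prime] (B : AbelianVariety ℚ),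
        (rationalTateRep B p).IsSemisimpleRepresentation) := by
  refine faltingsTateModuleQ_of_finite_isoClasses_isogenous fun P ↦ ?_
  intro _
  exact h P

end Summit.Langlands.Langlands.Theorems
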